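import Summits.QuantumFields.GaugeBoot.BootstrapLinkReflectionPositivity
import Summits.QuantumFields.GaugeBoot.BootstrapChargeConjugation
import Summits.QuantumFields.GaugeBoot.CentreSheetTwist
import HarnessLib

/-!
# The lattice bootstrap with ALL standard cuts is a sound, convergent relaxation (gauge-boot, L1 summary)

HONEST FRAMING (cell `pub-gaugeboot`, page 1 of every file): the venture produces certified bounds
on lattice expectations at stated coupling, gauge group, dimension and torus size; NOT a mass gap,
NOT a continuum limit, NOT a string tension; NOT Yang–Mills-summit-bearing (barriers
`FixedCouplingUltralocality`, `PerturbativeInvisibility`). Structural; it certifies no number.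

## Content

Summary module. The SDP a lattice bootstrap actually runs at word level `n` (`SU(N)` on the torus
`(ℤ/L)^d`): normalisation, the PSD moment matrix of the words of length `≤ n`, their loop equations
(`IsBootstrapFeasible`), PLUS invariance under the lattice symmetries (translations, axis
permutations, the site reflection), charge conjugation and the centre sheet twists, PLUS the site- and
link-reflection-positivity cuts. `allCutsLevelValuesSuN` is the set of values of an observable `P`
over its feasible functionals.

* `allSymmetries N` — the imposed symmetry maps; `allSymmetries_preserve_wilson_suN` — each preserves
  the Wilson measure;
* ★★★ `wilson_mem_allCutsLevelValues_suN` — the Wilson value is feasible at every level (even `L`,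
  `β ≥ 0` — the link-RP cut needs `β ≥ 0`);
* ★★★ `allCutsLevelValues_subset_Icc_suN` — the bounds converge to the Wilson value: for every
  polynomial `P` and `ε > 0`, eventually `allCutsLevelValuesSuN … n P ⊆ [W - ε, W + ε]`
  (`levelValues_subset_Icc_suN`); so with `wilson_mem_…` the feasible interval is nonempty and shrinks to
  `W = ∫ P dμ_Wilson`.

References: P. Anderson, M. Kruczenski, Nucl. Phys. B 921 (2017); V. Kazakov, Z. Zheng,
arXiv:2203.11360; arXiv:2404.16925. Folklore.
-/

noncomputable section

open MeasureTheory Filter Topology NormedSpace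
open Literature.MathematicalPhysics.QuantumFieldTheory (LatticeRep Site Edge GaugeConfig IsPositiveTimeObservable wilsonAction
  wilsonMeasure isProbabilityMeasure_wilsonMeasure edgePerm)
open Literature.MathematicalPhysics.QuantumFieldTheory.WilsonSiteRP (sitePosEdges sharedEdges)

namespace Summit.QuantumFields.GaugeBoot

open Literature.MathematicalPhysics.QuantumLattice

variable {d L : ℕ} [NeZero d] [NeZero L] (N : ℕ) (β : ℝ)

/-- **The symmetry maps a lattice bootstrap imposes** (`SU(N)`, torus): translations, axis
permutations, the site reflection, charge conjugation, and the centre sheet twists by the central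
elements of `SU(N)`. [folklore] -/
def allSymmetries : Set C(GaugeConfig d L (Matrix.specialUnitaryGroup (Fin N) ℂ), GaugeConfig d L (Matrix.specialUnitaryGroup (Fin N) ℂ)) :=
  (Set.range fun a : Site d L => relabelCM (G := Matrix.specialUnitaryGroup (Fin N) ℂ) (translateEquiv a)) ∪
    (Set.range fun σ : Equiv.Perm (Fin d) => relabelCM (G := Matrix.specialUnitaryGroup (Fin N) ℂ) (edgePerm (L := L) σ)) ∪
    {negReflectCM} ∪ {autCM (ι := Edge d L) (chargeConjSU N) (continuous_chargeConjSU N)} ∪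
    {R | ∃ (m : Fin d) (z : Matrix.specialUnitaryGroup (Fin N) ℂ),
      z ∈ Subgroup.center (Matrix.specialUnitaryGroup (Fin N) ℂ) ∧ R = sheetTwistCM m z}

/-- **Each imposed symmetry preserves the Wilson measure.** -/
theorem allSymmetries_preserve_wilson_suN :
    ∀ R ∈ allSymmetries (d := d) (L := L) N, ∀ f : C(GaugeConfig d L (Matrix.specialUnitaryGroup (Fin N) ℂ), ℝ),
      ∫ U, f (R U) ∂(wilsonMeasure (fundamentalRep (Fin N)) β) =
        ∫ U, f U ∂(wilsonMeasure (d := d) (L := L) (fundamentalRep (Fin N)) β) := by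
  rintro R ((((⟨a, rfl⟩ | ⟨σ, rfl⟩) | hR) | hR) | ⟨m, z, hz, rfl⟩) f
  · exact integral_comp_translateEquiv_eq_wilson (fundamentalRep (Fin N)) β a f
  · exact integral_comp_edgePerm_eq_wilson (fundamentalRep (Fin N)) (continuous_fundamentalRep _) β σ f
  · rw [Set.mem_singleton_iff.1 hR]
    exact integral_comp_negReflectCM_eq_wilson (fundamentalRep (Fin N)) (continuous_fundamentalRep _) β f
  · rw [Set.mem_singleton_iff.1 hR]
    exact integral_comp_aut_eq_wilson (chargeConjSU N) (fundamentalRep (Fin N)) (continuous_chargeConjSU N)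
      (chargeConjSU_involutive N) (trace_re_chargeConjSU N) β f
  · exact integral_comp_sheetTwist_eq_wilson (fundamentalRep (Fin N)) hz β f

/-- **The feasible values of `P` in the word-level-`n` SDP with ALL standard cuts**: moment-matrix
positivity + loop equations on the words of length `≤ n`, invariance under `allSymmetries` on the
level-`n` test functions, site-RP cuts and link-RP cuts. [folklore] -/
def allCutsLevelValuesSuN (n : ℕ) (P : C(GaugeConfig d L (Matrix.specialUnitaryGroup (Fin N) ℂ), ℝ)) : Set ℝ :=
  {t | ∃ φ : C(GaugeConfig d L (Matrix.specialUnitaryGroup (Fin N) ℂ), ℝ) →ₗ[ℝ] ℝ,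
    IsBootstrapFeasible (fundamentalLatticeRep N) (suExp N)
        (fun _ => wilsonAction (fundamentalRep (Fin N))) β
        (wordTruncation (ι := Edge d L) (fundamentalLatticeRep N) n) φ ∧
      (∀ R ∈ allSymmetries (d := d) (L := L) N, ∀ v ∈ wordTruncation (ι := Edge d L) (fundamentalLatticeRep N) n,
        φ (v.comp R) = φ v) ∧
      (∀ v ∈ wordTruncation (ι := Edge d L) (fundamentalLatticeRep N) n,
        DependsOn (⇑v) ((sitePosEdges ∪ sharedEdges : Finset (Edge d L)) : Set (Edge d L)) →
          0 ≤ φ (v.comp negReflectCM * v)) ∧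
      (∀ v ∈ wordTruncation (ι := Edge d L) (fundamentalLatticeRep N) n,
        IsPositiveTimeObservable (⇑v) → 0 ≤ φ (v.comp timeReflectCM * v)) ∧
      φ P = t}

/-- All cuts together shrink the feasible set of the plain word truncation. -/
theorem allCutsLevelValues_subset_levelValues (n : ℕ) (P : C(GaugeConfig d L (Matrix.specialUnitaryGroup (Fin N) ℂ), ℝ)) :
    allCutsLevelValuesSuN (d := d) (L := L) N β n P ⊆ levelValuesSuN (d := d) (L := L) N β n P := by
  rintro t ⟨φ, hφ, -, -, -, rfl⟩
  exact ⟨φ, hφ, rfl⟩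

/-- ★★★ **The Wilson value is feasible in the SDP with all cuts, at every level** (even `L`,
`β ≥ 0`). [folklore] -/
theorem wilson_mem_allCutsLevelValues_suN (hL : Even L) (hβ : 0 ≤ β) (n : ℕ)
    (P : C(GaugeConfig d L (Matrix.specialUnitaryGroup (Fin N) ℂ), ℝ)) :
    ∫ U, P U ∂(wilsonMeasure (fundamentalRep (Fin N)) β) ∈ allCutsLevelValuesSuN (d := d) (L := L) N β n P := by
  haveI : IsProbabilityMeasure (wilsonMeasure (d := d) (L := L) (fundamentalRep (Fin N)) β) :=
    isProbabilityMeasure_wilsonMeasure (ρ := fundamentalRep (Fin N)) (continuous_fundamentalRep _) β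
  refine ⟨expectationFunctional (wilsonMeasure (fundamentalRep (Fin N)) β),
    isBootstrapFeasible_wilson_suN N β _ rfl (wordTruncation_subset_polyAlgebra _ n), fun R hR v _ => ?_,
    fun v _ hdep => ?_, fun v _ hvt => ?_, rfl⟩
  · rw [expectationFunctional_apply, expectationFunctional_apply]
    exact allSymmetries_preserve_wilson_suN N β R hR v
  · rw [expectationFunctional_apply]
    simpa only [ContinuousMap.mul_apply, ContinuousMap.comp_apply] using
      wilson_siteRP_real (fundamentalRep (Fin N)) hL (continuous_fundamentalRep _) β v hdep
  · rw [expectationFunctional_apply]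
    simpa only [ContinuousMap.mul_apply, ContinuousMap.comp_apply] using
      wilson_linkRP_real (fundamentalRep (Fin N)) hL (continuous_fundamentalRep _) hβ v hvt

/-- ★★★ **The bounds of the SDP with all cuts converge to the Wilson value**: for every polynomial
observable `P` and `ε > 0`, for all large `n` the feasible values lie in `[W - ε, W + ε]`. [folklore] -/
theorem allCutsLevelValues_subset_Icc_suN {P : C(GaugeConfig d L (Matrix.specialUnitaryGroup (Fin N) ℂ), ℝ)}
    (hP : P ∈ polyAlgebra (ι := Edge d L) (fundamentalLatticeRep N)) {ε : ℝ} (hε : 0 < ε) :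
    ∀ᶠ n in atTop, allCutsLevelValuesSuN (d := d) (L := L) N β n P ⊆
      Set.Icc (∫ U, P U ∂(wilsonMeasure (fundamentalRep (Fin N)) β) - ε)
        (∫ U, P U ∂(wilsonMeasure (fundamentalRep (Fin N)) β) + ε) := by
  filter_upwards [levelValues_subset_Icc_suN N β hP hε] with n hn
  exact (allCutsLevelValues_subset_levelValues N β n P).trans hn

/-- ★★★ **Summary**: even `L`, `β ≥ 0`, any `d ≥ 1`, `N`: the lattice bootstrap with all standard cuts
has, for every polynomial observable, a NONEMPTY feasible interval at every level containing the
Wilson value, and these intervals shrink to it. [folklore] -/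
theorem allCuts_bootstrap_sound_and_convergent_suN (hL : Even L) (hβ : 0 ≤ β)
    {P : C(GaugeConfig d L (Matrix.specialUnitaryGroup (Fin N) ℂ), ℝ)}
    (hP : P ∈ polyAlgebra (ι := Edge d L) (fundamentalLatticeRep N)) {ε : ℝ} (hε : 0 < ε) :
    (∀ n, ∫ U, P U ∂(wilsonMeasure (fundamentalRep (Fin N)) β) ∈ allCutsLevelValuesSuN (d := d) (L := L) N β n P) ∧
      ∀ᶠ n in atTop, allCutsLevelValuesSuN (d := d) (L := L) N β n P ⊆
        Set.Icc (∫ U, P U ∂(wilsonMeasure (fundamentalRep (Fin N)) β) - ε)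
          (∫ U, P U ∂(wilsonMeasure (fundamentalRep (Fin N)) β) + ε) :=
  ⟨fun n => wilson_mem_allCutsLevelValues_suN N β hL hβ n P, allCutsLevelValues_subset_Icc_suN N β hP hε⟩

end Summit.QuantumFields.GaugeBoot

end
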